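import Summits.ValiantsHypothesis.ValiantsHypothesis.Theorems.BinomialElusivePeelingLemmaRigidity
import Summits.ValiantsHypothesis.ValiantsHypothesis.Theorems.BinomialElusivePeelingLemmaPeriodicity

/-!
# One arm of the `S⁻` analysis: vanishing readings + small mass ⇒ Case A / Case B (§3g STEP 3)

Helper for the crux stmt-ValiantsHypothesis-7391 (negative lane; `Cruxes/PeelingLemma/DETERMINISTIC-ALLX.md`
§3h (E4)).  The per-arm wrapper of `rigid_caseA` / `rigid_caseB`: INPUT = the antisymmetric edge
content `d` of one arm (zero from `M` on; every window of `2q` consecutive edges has mass `≤ ℓ < 2q`)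
and the vanishing of the `S⁻`-readings of its private letters born at `t₀ ≤ M` off one residue class
`v (mod 2q+1)` (as alternating window sums of the vertex charges `g t = d t - d (t-1)`, the form
delivered by `vsum_apply_private`); OUTPUT = the rigid shape of §3g: for `1 ≤ v ≤ 2q` the alternating
prefix sums `P` vanish on `[0,2q] ∖ {v}`, `d 0 = -2(-1)^v P v`, `d = d 0` below `v`, `d v = -(-1)^v P v`,
`d (v+1) = 0` (`arm_rigid_caseA`); for `v = 0`, `P s = d 0` on `[1, 2q]` (`arm_rigid_caseB`).  Here
`P s = Σ_{t ∈ [1,s]} (-1)^t (d t - d (t-1))` is the arm's contribution to the reading of the `b`-letter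
of age-index `s` (`vsum_apply_beta`).  No windows, no Theses import.
-/

namespace Summit.ValiantsHypothesis.ValiantsHypothesis.Theorems.PeelingLemmaRigidity

-- summit = sub-problem name (single-conjunct summit, D-0017 layout), so the namespace repeats it
set_option linter.dupNamespace false

open scoped BigOperators
open Finset

/-- The alternating prefix sum of the vertex charges of `d`. -/
theorem prefix_succ (d : ℕ → ℤ) (t : ℕ) (ht : 1 ≤ t) :
    (∑ s ∈ Finset.Icc 1 t, (-1 : ℤ) ^ s * (d s - d (s - 1))) -
        ∑ s ∈ Finset.Icc 1 (t - 1), (-1 : ℤ) ^ s * (d s - d (s - 1)) =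
      (-1) ^ t * (d t - d (t - 1)) := by
  obtain ⟨t, rfl⟩ : ∃ t', t = t' + 1 := ⟨t - 1, by omega⟩
  rw [Nat.add_sub_cancel, Finset.sum_Icc_succ_top (by omega), Nat.add_sub_cancel]
  ring

/-- The common hypotheses of `rigid_caseA/B` for one arm, from vanishing readings and finite support.
Returns the periodicity off the class `v` and the eventual constancy of `P`. -/
theorem arm_periodic {q v M : ℕ} (d : ℕ → ℤ) (hdM : ∀ t, M ≤ t → d t = 0)
    (hread : ∀ t₀, 1 ≤ t₀ → t₀ ≤ M → (t₀ - 1) % (2 * q + 1) ≠ v →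
      ∑ t ∈ Finset.Icc t₀ (t₀ + 2 * q), (-1 : ℤ) ^ (t - t₀) * (d t - d (t - 1)) = 0) :
    (∀ s, M ≤ s → (∑ t ∈ Finset.Icc 1 s, (-1 : ℤ) ^ t * (d t - d (t - 1))) =
        ∑ t ∈ Finset.Icc 1 M, (-1 : ℤ) ^ t * (d t - d (t - 1))) ∧
    (∀ s, s % (2 * q + 1) ≠ v →
      (∑ t ∈ Finset.Icc 1 (s + (2 * q + 1)), (-1 : ℤ) ^ t * (d t - d (t - 1))) =
        ∑ t ∈ Finset.Icc 1 s, (-1 : ℤ) ^ t * (d t - d (t - 1))) := by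
  set P : ℕ → ℤ := fun s => ∑ t ∈ Finset.Icc 1 s, (-1 : ℤ) ^ t * (d t - d (t - 1)) with hP
  have hPg : ∀ t, 1 ≤ t → P t - P (t - 1) = (-1) ^ t * (d t - d (t - 1)) := fun t ht => prefix_succ d t ht
  have hg : ∀ t, M < t → d t - d (t - 1) = 0 := fun t ht => by
    rw [hdM t (by omega), hdM (t - 1) (by omega), sub_zero]
  have hconst : ∀ s, M ≤ s → P s = P M := prefix_const_of_zero (g := fun t => d t - d (t - 1)) hPg hg
  refine ⟨hconst, fun s hs => ?_⟩
  by_cases hsM : M ≤ s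
  · show P (s + (2 * q + 1)) = P s
    rw [hconst s hsM, hconst _ (by omega)]
  · exact periodic_of_window_zero (g := fun t => d t - d (t - 1)) hPg q s
      (hread (s + 1) (by omega) (by omega) (by rw [Nat.add_sub_cancel]; exact hs))

/-- **Case A for one arm.**  See the file header. -/
theorem arm_rigid_caseA {q v M ℓ : ℕ} (hv1 : 1 ≤ v) (hv2 : v ≤ 2 * q) (hℓ : ℓ < 2 * q) (d : ℕ → ℤ)
    (hdM : ∀ t, M ≤ t → d t = 0)
    (hmass : ∀ a, ∑ t ∈ Finset.Ico a (a + 2 * q), |d t| ≤ ℓ)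
    (hread : ∀ t₀, 1 ≤ t₀ → t₀ ≤ M → (t₀ - 1) % (2 * q + 1) ≠ v →
      ∑ t ∈ Finset.Icc t₀ (t₀ + 2 * q), (-1 : ℤ) ^ (t - t₀) * (d t - d (t - 1)) = 0) :
    (∀ s, s ≤ 2 * q → s ≠ v → (∑ t ∈ Finset.Icc 1 s, (-1 : ℤ) ^ t * (d t - d (t - 1))) = 0) ∧
    (∀ t, t < v → d t = d 0) ∧
    d 0 = -2 * (-1) ^ v * ∑ t ∈ Finset.Icc 1 v, (-1 : ℤ) ^ t * (d t - d (t - 1)) ∧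
    d v = -((-1) ^ v * ∑ t ∈ Finset.Icc 1 v, (-1 : ℤ) ^ t * (d t - d (t - 1))) ∧
    d (v + 1) = 0 := by
  obtain ⟨hconst, hper⟩ := arm_periodic (q := q) (v := v) d hdM hread
  have h := rigid_caseA (q := q) (v := v) (M := M) hv1 hv2
    (fun s => ∑ t ∈ Finset.Icc 1 s, (-1 : ℤ) ^ t * (d t - d (t - 1))) (fun t => d t - d (t - 1)) d
    (∑ t ∈ Finset.Icc 1 M, (-1 : ℤ) ^ t * (d t - d (t - 1))) (by simp) hconst hper
    (fun t ht => prefix_succ d t ht) (fun t _ => rfl)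
    (fun hc => flat_zero_of_small_mass (q := q) d (lt_of_le_of_lt (hmass (v + 1)) (by exact_mod_cast hℓ))
      (fun t h1 h2 => hc t h1 (by omega)))
  exact ⟨h.2.1, h.2.2.1, h.2.2.2.1, h.2.2.2.2.1, h.2.2.2.2.2⟩

/-- **Case B for one arm** (`v = 0`: the exceptional letter is the arm's oldest): `P s = d 0` on
`[1, 2q]`, i.e. this arm contributes the constant `d 0` to the reading of every other `b`-letter. -/
theorem arm_rigid_caseB {q M ℓ : ℕ} (hq : 1 ≤ q) (hℓ : ℓ < 2 * q) (d : ℕ → ℤ)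
    (hdM : ∀ t, M ≤ t → d t = 0)
    (hmass : ∀ a, ∑ t ∈ Finset.Ico a (a + 2 * q), |d t| ≤ ℓ)
    (hread : ∀ t₀, 1 ≤ t₀ → t₀ ≤ M → (t₀ - 1) % (2 * q + 1) ≠ 0 →
      ∑ t ∈ Finset.Icc t₀ (t₀ + 2 * q), (-1 : ℤ) ^ (t - t₀) * (d t - d (t - 1)) = 0) :
    ∀ s, 1 ≤ s → s ≤ 2 * q → (∑ t ∈ Finset.Icc 1 s, (-1 : ℤ) ^ t * (d t - d (t - 1))) = d 0 := by
  obtain ⟨hconst, hper⟩ := arm_periodic (q := q) (v := 0) d hdM hread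
  have h := rigid_caseB (q := q) (M := M) hq
    (fun s => ∑ t ∈ Finset.Icc 1 s, (-1 : ℤ) ^ t * (d t - d (t - 1))) (fun t => d t - d (t - 1)) d
    (∑ t ∈ Finset.Icc 1 M, (-1 : ℤ) ^ t * (d t - d (t - 1))) (by simp) hconst hper
    (fun t ht => prefix_succ d t ht) (fun t _ => rfl)
    (fun hc => flat_zero_of_small_mass (q := q) d (lt_of_le_of_lt (hmass 1) (by exact_mod_cast hℓ))
      (fun t h1 h2 => hc t h1 (by omega)))
  exact h.2

end Summit.ValiantsHypothesis.ValiantsHypothesis.Theorems.PeelingLemmaRigidity
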